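import Summits.BirchSwinnertonDyer.BirchSwinnertonDyer.Theorems.RamifiedHeegnerPairLeafUpperMembersOfReadingOptimalOffRows
import Summits.BirchSwinnertonDyer.BirchSwinnertonDyer.Theorems.KatoDescentTamePotSupersingularJetchevIrreducibleSwapNodeTwoGuard
import HarnessLib

/-!
# Route `RamifiedHeegnerPair`, crux U₁ `LeafRankOneUpperAtThree` (stmt-BirchSwinnertonDyer-26022), line `splitkolyvagin` —
# the S2 EXIT, part 1: the U₁ chain re-threaded with the Jetchev reading asked ONLY in Heegner fields in which `2` SPLITS,
# and that reading DISCHARGED from three named print facts (cell `bsd-potss`, k9-c4 g11's swap node)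

HONEST FRAMING. Theorems only; helper file (`--supports stmt-BirchSwinnertonDyer-26022 --as helper`); nothing is booked,
no item is closed, BSD is not proved for any curve; CONDITIONAL on every displayed input. Lead prover bsd-line-rhp-p2 g8,
2026-08-28.

THE OBSERVATION. Every composition of this route that consumes the reading-grade child S2 (item 27492
`JetchevDivisibilityReadingS2` = `bsd-potss`'s `Sig.S2DivisibilityIrredAddv` VERBATIM) picks its Heegner field by
Friedberg–Hoffstein with the prime `2` SPLIT (`hFH W hw 2 …` in p610955's `leafRankOneUpper_three_of_sigmaAtDatum_of_lowerRankZero`,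
`hBFH W hw {2} …` on the rank-zero side): the reading is therefore only ever used on rows `(E, K, 3)` on which `2` is NOT a
Kolyvagin prime. On exactly those rows `bsd-potss` (k9-c4 g11, `…JetchevIrreducibleSwapNodeTwoGuard` §3,
`JetchevIrreducibleSwapAtP.rowDivisibilityIrredAddv_of_namedFacts_of_heegnerHypothesis_two`) PROVED the body of S2 from THREE
NAMED PRINT FACTS: Gross 1991 Prop. 3.7 (2) (`GrossLMS1991.prop37_2_frobeniusCongruence`), Poitou–Tate duality for the
tree's Selmer structures (`GaloisCohomology.poitouTate_selmerStructure_duality_conj`, Milne ADT I Thm. 4.10) and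
[GZ86 III (3.1)] image-free (`Gross1991_heegnerPoint_sub_ratTorsion_mem_E0_imageFree`). The residue of S2 as TYPED (all `K`)
is the corner «`p = 3`, `a₂(E) = 0`, `2` inert in `K`, `ρ̄_{E,3}` irreducible non-surjective» (the Kolyvagin prime `ℓ₀ = 2`,
where Gross 3.7 (2) is typed only under surjectivity) — a corner the U-compositions never visit.

* §1 `leafRankOneUpper_three_of_sigmaAtDatumTwoSplit_of_lowerRankZero` — p610955 §1 with the Σ-callback ALSO receiving
  `SatisfiesHeegnerHypothesis 2 K` (the field is the same Friedberg–Hoffstein field; proof byte-parallel).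
* §2 `leafRankOneUpper_three_monoCarrier_of_twoSplitReading_of_lowerRankZero` — p615347 §2 with the reading S2 replaced by
  the 2-SPLIT reading S2|₂ := S2 with ONE extra binder `SatisfiesHeegnerHypothesis 2 K` (right after the Heegner hypothesis).
* §3 `twoSplitReading_of_namedFacts` — S2|₂ ⟸ the three named facts (potss's row theorem, re-packaged in the binder order
  of this route); `leafRankOneUpper_three_monoCarrier_of_namedFacts_of_lowerRankZero` — U₁ on a mono-multiplicative-carrier
  row from print + the three facts + L₀: NO S2.

Part 2 (`…LeafRankOneUpperAtThreeOfNamedFacts.lean`) threads §2 through the optimal member and lands the route decl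
`LeafRankOneUpperAtThree` ⟸ PUB⁺ ∧ three named facts ∧ Σ★″ (27493) ∧ L₀ (26023). References: [cite: Jetchev2008, Thm. 1.4
and Cor. 1.5 (p. 812), Rem. 6.2] [cite: GrossLMS1991, Prop. 3.7 (2) (p. 240), §6 p. 245] [cite: GrossZagier1986, III (3.1);
Thm. I.(6.3) and (7.3)] [cite: MilneADT2006, Ch. I, Thm. 4.10(b)] [cite: MatarNekovar2019, Thm. 0.7 (p. 456)]
[cite: FriedbergHoffstein1995, Thm. B] [cite: Miller2011LMS, Def. 1.1].
-/

-- D-0017: single-problem summit, so `Summit.BirchSwinnertonDyer.BirchSwinnertonDyer.…` repeats a namespace BY DESIGN.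
set_option linter.dupNamespace false
set_option autoImplicit false

noncomputable section

open scoped Classical NumberField

open WeierstrassCurve IsDedekindDomain IsDedekindDomain.HeightOneSpectrum NumberField
  Rat.HeightOneSpectrum Literature Literature.NumberTheory.EllipticCurves
  Literature.NumberTheory.EllipticCurves.ModularForms
  Literature.NumberTheory.EllipticCurves.Rank1Residual
  Literature.NumberTheory.EllipticCurves.Rank1Residual.Typed
  Literature.NumberTheory.EllipticCurves.KrizLi2019
  Literature.NumberTheory.QuadraticFields
  Summit.BirchSwinnertonDyer.Rank1Residual
  Summit.BirchSwinnertonDyer.Rank1Residual.Additive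
  Summit.BirchSwinnertonDyer.Rank1Residual.X11b.Three
  Summit.BirchSwinnertonDyer.BirchSwinnertonDyer.Theses.RamifiedHeegnerPair
  Summit.BirchSwinnertonDyer.BirchSwinnertonDyer.Theorems
  Summit.BirchSwinnertonDyer.BirchSwinnertonDyer.Theorems.SchneiderFree

namespace Summit.BirchSwinnertonDyer.BirchSwinnertonDyer.Theorems.RamifiedPairUpperBound

/-! ## §1 One datum: Σ asked only in the Friedberg–Hoffstein field, WITH the datum «`2` splits in `K`» handed to Σ -/

/-- **U₁ AT `W` from Σ AT ONE PARAMETRISATION DATUM, the callback told that `2` splits** — p610955's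
`leafRankOneUpper_three_of_sigmaAtDatum_of_lowerRankZero` with ONE more datum passed to the Σ-callback:
`SatisfiesHeegnerHypothesis 2 K` (the Friedberg–Hoffstein field is chosen with `2` split anyway; `d_K` odd follows).
For a non-CM leaf `W` (`Addv W 3`, `SubGss W 3`) of analytic rank one and a datum `Dt` at level `N_E`: IF Σ holds at
`Dt` for every imaginary quadratic `K′` with the Heegner hypothesis for `N_E` AND for `2`, `L(W^{(d_{K′})},1) ≠ 0`, odd
`d_{K′}`, every Heegner datum and the (non-torsion) Heegner point, and every non-CM rank-zero leaf curve has its lower half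
(`hL0` = item 26023), THEN `Typed.MissingUpperBoundAt W 3`, given the printed facts. Proof byte-parallel to p610955 §1.
[cite: FriedbergHoffstein1995, Thm. B] [cite: MatarNekovar2019, Thm. 0.7 (p. 456)] [cite: Jetchev2008, Conj. 1.3]
[cite: GrossZagier1986, Thm. I.(6.3) and (7.3)] [cite: Miller2011LMS, Def. 1.1] -/
theorem leafRankOneUpper_three_of_sigmaAtDatumTwoSplit_of_lowerRankZero
    (hGZ : ∀ (N : ℕ) [NeZero N] (W : WeierstrassCurve ℚ) (K : Type) [Field K] [NumberField K],
      gross_zagier N W K)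
    (hKo : ∀ (N : ℕ) [NeZero N] (W : WeierstrassCurve ℚ) (K : Type) [Field K] [NumberField K],
      kolyvagin N W K)
    (hGZK : rank_eq_analyticRank_of_analyticRank_le_one) (hmod : hasEntireLFunction_rat)
    (hGZ73 : GrossZagier1986_thm_I_7_3)
    (hMN : MatarNekovar2019.thm07_padicValNat_card_sha_primary_add_le_of_globalDivisibility_of_irreducible)
    (hnf : exists_isNewformOf) (hFH : friedbergHoffstein_exists_heegnerField_splitDivisors_twist_ne_zero)
    (hL0 : Gss2LowerAtThreeRankZero)
    (W : WeierstrassCurve ℚ) [W.IsElliptic] [W.IsGloballyMinimal] [NeZero (W.conductorNorm ℤ)]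
    (hCM : ¬ W.HasCM) (hadd : Addv W 3) (hsub : SubGss W 3) (hr : W.analyticRank = 1)
    (Dt : ModularParametrizationData W (W.conductorNorm ℤ))
    (hSig : ∀ (K : Type) [Field K] [NumberField K]
      (H : HeegnerDatum (W.conductorNorm ℤ) (NumberField.discr K)) (ι : K →+* ℂ) (P : (W.baseChange K).toAffine.Point),
      IsImaginaryQuadratic K → SatisfiesHeegnerHypothesis (W.conductorNorm ℤ) K → SatisfiesHeegnerHypothesis 2 K →
      (W.quadraticTwist (NumberField.discr K : ℚ)).entireLFunction 1 ≠ 0 →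
      WeierstrassCurve.Affine.Point.map ι.toRatAlgHom P = heegnerPointComplex Dt H → ¬ IsOfFinAddOrder P →
      Odd (NumberField.discr K) →
      ∀ (s' : ℕ), s' ≤ padicValNat 3 W.tamagawaProduct + padicValNat 3 Dt.c.natAbs →
      ∀ (n : ℕ) (d : KolyvaginHeegnerData Dt H.β ι n), Squarefree n →
      (∀ ℓ ∈ n.primeFactors, Zhang2014.IsKolyvaginPrime (W.conductorNorm ℤ) W K 3 ℓ ∧
        s' ≤ Zhang2014.kolyvaginIndex W 3 ℓ) → Koly.PDiv d 3 s') :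
    MissingUpperBoundAt W 3 := by
  -- the sign of the functional equation is `−1` (modularity, `r_an = 1`)
  have hw : W.rootNumber = -1 := by
    rw [WeierstrassCurve.rootNumber_eq_neg_one_pow_analyticRank_of_exists_isNewformOf hnf W, hr]
    norm_num
  -- the Friedberg–Hoffstein field: every `ℓ ∣ N_E` and `ℓ = 2` split, `L(E^{(d_K)},1) ≠ 0`
  obtain ⟨K, _, _, hK, -, hHN, hH2, hLt⟩ := hFH W hw 2 two_ne_zero 4
  have hodd : Odd (NumberField.discr K) := by
    have h2 : ¬ ((2 : ℕ) : ℤ) ∣ NumberField.discr K :=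
      Literature.SatisfiesHeegnerHypothesis.not_dvd_discr hK.1 hH2 Nat.prime_two (dvd_refl 2)
    rw [← Int.not_even_iff_odd, even_iff_two_dvd]
    exact_mod_cast h2
  -- the Heegner datum and the `K`-rational Heegner point of `Dt`
  obtain ⟨β, hβ⟩ := exists_dvd_sq_sub_discr_holds (W.conductorNorm ℤ) K hK hHN
  obtain ⟨H, -⟩ := nonempty_heegnerDatum_holds (W.conductorNorm ℤ) K hK hβ
  obtain ⟨ι⟩ : Nonempty (K →+* ℂ) := inferInstance
  obtain ⟨P, hP⟩ := heegnerPointComplex_mem_range_map_holds (W.conductorNorm ℤ) W K hK hHN Dt H ι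
  -- a globally minimal model of the twist: a non-CM LEAF curve of analytic rank `0`, so L₀ applies
  have hD0 : (NumberField.discr K : ℚ) ≠ 0 := by exact_mod_cast NumberField.discr_ne_zero K
  haveI hEt : (W.quadraticTwist (NumberField.discr K : ℚ)).IsElliptic := W.isElliptic_quadraticTwist hD0
  obtain ⟨Cd, hCd⟩ := hasGlobalMinimalModel_rat_holds (W.quadraticTwist (NumberField.discr K : ℚ))
  haveI : (Cd • W.quadraticTwist (NumberField.discr K : ℚ)).IsGloballyMinimal := hCd
  have hrd : (Cd • W.quadraticTwist (NumberField.discr K : ℚ)).analyticRank = 0 := by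
    rw [analyticRank_smul]
    exact analyticRank_eq_zero_of_entireLFunction_one_ne_zero _ hLt
  obtain ⟨hCMd, haddd, hsubd, -⟩ := leaf_twist_of_heegner W hCM hadd hsub K hK hHN hodd
    (Cd • W.quadraticTwist (NumberField.discr K : ℚ)) Cd rfl
  have hlow : MissingLowerBoundAt (Cd • W.quadraticTwist (NumberField.discr K : ℚ)) 3 :=
    hL0 _ hCMd haddd hsubd hrd
  -- the Heegner point is non-torsion (Gross–Zagier: `L′(E/K,1) = L′(E,1)·L(E^{(d_K)},1) ≠ 0`)
  have hL0W : W.entireLFunction 1 = 0 := entireLFunction_one_eq_zero_of_analyticRank_eq_one hr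
  obtain ⟨-, hderiv⟩ := leadingLCoeff_eq_deriv_of_analyticRank_eq_one hr
  have hLK : LDerivEK W K ≠ 0 := by
    rw [lDerivEK_eq_deriv_mul W K hmod hL0W]; exact mul_ne_zero hderiv hLt
  have hnt : ¬ IsOfFinAddOrder P :=
    (lDerivEK_ne_zero_iff_not_isOfFinAddOrder W (W.conductorNorm ℤ) K (hGZ _ W K) hK hHN
      ⟨Dt, H, ι, hP⟩).mp hLK
  -- Σ at this datum ⟹ the socket (p607279's receptacle) ⟹ the upper half (p606327 §2)
  exact leafRankOneUpper_three_of_globalDivisibility_of_twistLower hGZ hKo hGZK hmod hGZ73 hMN W hCM hadd hsub hr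
    K Dt H ι P (Cd • W.quadraticTwist (NumberField.discr K : ℚ)) hK hodd hHN hLt hP ⟨Cd, rfl⟩
    (fun s' hs' n d hn hℓ ↦ hSig K H ι P hK hHN hH2 hLt hP hnt hodd s' hs' n d hn hℓ) hlow

/-! ## §2 One datum on a mono-multiplicative-carrier row: Σ at the datum is the 2-SPLIT reading S2|₂ -/

/-- **U₁ ON ONE MONO-MULTIPLICATIVE-CARRIER ROW from the 2-SPLIT READING S2|₂** — p615347's
`leafRankOneUpper_three_monoCarrier_of_divisibilityReading_of_lowerRankZero` with its displayed input `hD` (S2 = the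
divisibility reading of Jetchev 2008 Thm. 1.4 at one multiplicative Tamagawa carrier, `bsd-potss`'s binder VERBATIM)
replaced by the WEAKER input `hD₂` = S2|₂ := S2 with ONE extra binder «`SatisfiesHeegnerHypothesis 2 K`» (the prime `2`
splits in the Heegner field, so `2` is never a Kolyvagin prime of the row). Data and output as in p615347 §2:
`W/ℚ` globally minimal, non-CM, leaf Gss2 at `3`, `r_an(W) = 1`; `q ∥ N_E` carrying the whole `3`-part of the Tamagawa
product; the reading's global Tamagawa binder; a datum `Dt` with `3 ∤ c(Dt)`; OUTPUT `Typed.MissingUpperBoundAt W 3`.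
Proof byte-parallel, through §1 (whose callback now supplies `SatisfiesHeegnerHypothesis 2 K`). CONDITIONAL on `hD₂`, the
named facts and L₀; nothing asserted about any curve. [cite: Jetchev2008, Thm. 1.4 and Cor. 1.5 (p. 812), Rem. 6.2, Thm. 6.3]
[cite: MatarNekovar2019, Thm. 0.7 (p. 456) and §0.11 (p. 457)] [cite: FriedbergHoffstein1995, Thm. B]
[cite: GrossZagier1986, Thm. I.(6.3) and (7.3)] [cite: Miller2011LMS, Def. 1.1] -/
theorem leafRankOneUpper_three_monoCarrier_of_twoSplitReading_of_lowerRankZero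
    (hGZ : ∀ (N : ℕ) [NeZero N] (W : WeierstrassCurve ℚ) (K : Type) [Field K] [NumberField K],
      gross_zagier N W K)
    (hKo : ∀ (N : ℕ) [NeZero N] (W : WeierstrassCurve ℚ) (K : Type) [Field K] [NumberField K],
      kolyvagin N W K)
    (hGZK : rank_eq_analyticRank_of_analyticRank_le_one) (hmod : hasEntireLFunction_rat)
    (hGZ73 : GrossZagier1986_thm_I_7_3)
    (hMN : MatarNekovar2019.thm07_padicValNat_card_sha_primary_add_le_of_globalDivisibility_of_irreducible)
    (hnf : exists_isNewformOf) (hFH : friedbergHoffstein_exists_heegnerField_splitDivisors_twist_ne_zero)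
    (hD₂ : ∀ (W : WeierstrassCurve ℚ) [W.IsElliptic] [W.IsGloballyMinimal] [NeZero (W.conductorNorm ℤ)],
      ¬ W.HasCM →
      ∀ (K : Type) [Field K] [NumberField K], IsImaginaryQuadratic K →
      NumberField.discr K ≠ -3 → NumberField.discr K ≠ -4 →
      SatisfiesHeegnerHypothesis (W.conductorNorm ℤ) K → SatisfiesHeegnerHypothesis 2 K →
      ∀ (p : ℕ) [Fact p.Prime], p ≠ 2 → Addv W p → 0 ≤ padicValRat p W.j →
      W.HasIrreducibleModPGaloisRep p →
      ¬ p ∣ (W.baseChange ℚ_[p]).localTamagawaNumber ℤ_[p] →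
      (∀ (q' : ℕ) [Fact q'.Prime], q' ∣ W.conductorNorm ℤ →
        p ∣ (W.baseChange ℚ_[q']).localTamagawaNumber ℤ_[q'] → ¬ q' ^ 2 ∣ W.conductorNorm ℤ) →
      ∀ (Dt : ModularParametrizationData W (W.conductorNorm ℤ)) (β : ℤ) (ι : K →+* ℂ)
        (d₁ : KolyvaginHeegnerData Dt β ι 1), ¬ IsOfFinAddOrder d₁.derivedPoint →
      ∀ (q : ℕ) [Fact q.Prime], q ∣ W.conductorNorm ℤ → ¬ q ^ 2 ∣ W.conductorNorm ℤ → q ≠ p →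
      ∀ (s : ℕ), s ≤ padicValNat p ((W.baseChange ℚ_[q]).localTamagawaNumber ℤ_[q]) →
      ∀ (n : ℕ) (d : KolyvaginHeegnerData Dt β ι n), Squarefree n →
        (∀ ℓ ∈ n.primeFactors, Zhang2014.IsKolyvaginPrime (W.conductorNorm ℤ) W K p ℓ ∧
          s ≤ Zhang2014.kolyvaginIndex W p ℓ) →
        ∃ Q : (W.baseChange (ringClassField K ι n)).toAffine.Point,
          ((p ^ s : ℕ) : ℤ) • Q = d.derivedPoint)
    (hL0 : Gss2LowerAtThreeRankZero)
    (W : WeierstrassCurve ℚ) [W.IsElliptic] [W.IsGloballyMinimal] [NeZero (W.conductorNorm ℤ)]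
    (hCM : ¬ W.HasCM) (hadd : Addv W 3) (hsub : SubGss W 3) (hr : W.analyticRank = 1)
    (q : ℕ) [Fact q.Prime] (hqN : q ∣ W.conductorNorm ℤ) (hq2 : ¬ q ^ 2 ∣ W.conductorNorm ℤ)
    (hmono : padicValNat 3 W.tamagawaProduct ≤ padicValNat 3 ((W.baseChange ℚ_[q]).localTamagawaNumber ℤ_[q]))
    (htam : ∀ (q' : ℕ) [Fact q'.Prime], q' ∣ W.conductorNorm ℤ →
      3 ∣ (W.baseChange ℚ_[q']).localTamagawaNumber ℤ_[q'] → ¬ q' ^ 2 ∣ W.conductorNorm ℤ)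
    (Dt : ModularParametrizationData W (W.conductorNorm ℤ)) (hc : ¬ (3 : ℤ) ∣ Dt.c) :
    MissingUpperBoundAt W 3 := by
  -- the leaf discharges the reading's local binders at `p = 3`
  have hirr : W.HasIrreducibleModPGaloisRep 3 := (classX4_three_of_addv_of_subGss W hadd hsub).2.2
  have hj : 0 ≤ padicValRat 3 W.j := padicValRat_j_nonneg_of_subGss_three W hadd hsub
  have hc3 : ¬ 3 ∣ (W.baseChange ℚ_[3]).localTamagawaNumber ℤ_[3] :=
    not_three_dvd_localTamagawaNumber_three_of_subGss W hadd hsub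
  have h3N : 3 ∣ W.conductorNorm ℤ :=
    (W.dvd_conductorNorm_iff_not_hasGoodReductionAtPrime 3).mpr (not_good_of_addv W 3 hadd)
  have hc0 : padicValNat 3 Dt.c.natAbs = 0 :=
    padicValNat.eq_zero_of_not_dvd fun h ↦ hc (Int.ofNat_dvd_left.mpr h)
  refine leafRankOneUpper_three_of_sigmaAtDatumTwoSplit_of_lowerRankZero hGZ hKo hGZK hmod hGZ73 hMN hnf hFH hL0 W hCM
    hadd hsub hr Dt ?_
  intro K _ _ H ι P hK hHN hH2 hLt hP hnt hodd s' hs' n d hn hℓ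
  -- depth `0` is free
  rcases Nat.eq_zero_or_pos s' with hs0 | hspos
  · subst hs0
    exact koly_pDiv_zero d 3
  -- positive depth: `3 ∣ c_q`, so the carrier `q` is not `3`
  have hsq : s' ≤ padicValNat 3 ((W.baseChange ℚ_[q]).localTamagawaNumber ℤ_[q]) := by omega
  have hq3 : q ≠ 3 := by
    rintro rfl
    have hpos : 0 < padicValNat 3 ((W.baseChange ℚ_[3]).localTamagawaNumber ℤ_[3]) := by omega
    exact hc3 (dvd_of_one_le_padicValNat hpos)
  -- `d_K ∉ {-3, -4}`: `3 ∣ N_E` splits in `K`, `d_K` odd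
  have h3 : NumberField.discr K ≠ -3 := by
    intro h
    exact (X11b.Three.not_dvd_discr_and_not_dvd_torsionOrder_of_heegner hK hHN (by decide) h3N).1
      (h ▸ ⟨-1, by norm_num⟩)
  have h4 : NumberField.discr K ≠ -4 := by
    intro h
    rw [h] at hodd
    exact (Int.not_odd_iff_even.mpr ⟨-2, by norm_num⟩) hodd
  -- the conductor-`1` Kolyvagin–Heegner datum on the frame, with bottom point `P` (Darmon 3.6 / Shimura, proved)
  obtain ⟨d₁⟩ := exists_kolyvaginHeegnerData_one
    (phi_heegnerTau_mem_singularModuliField_holds (W.conductorNorm ℤ) W K) hK Dt H.β ι H.dvd_sq_sub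
  have hPd : d₁.toGeomPoints d₁.derivedPoint = toGeomPoints (W.baseChange K) P :=
    X11b.KolyvaginBottom.toGeomPoints_derivedPoint_one_eq
      (heegnerPointOfConductor_one_galoisConj_holds (W.conductorNorm ℤ) W K) hK hHN hP d₁ rfl
  have hy₁ : ¬ IsOfFinAddOrder d₁.derivedPoint := by
    intro hfin
    apply hnt
    have h1 : IsOfFinAddOrder (d₁.toGeomPoints d₁.derivedPoint) := d₁.toGeomPoints.isOfFinAddOrder hfin
    rw [hPd] at h1
    exact (toGeomPoints_injective (W.baseChange K)).isOfFinAddOrder_iff.mp h1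
  -- S2|₂ at `p = 3`, carrier `q`, depth `s'`, in the field `K` in which `2` splits
  exact hD₂ W hCM K hK h3 h4 hHN hH2 3 (by decide) hadd hj hirr hc3 htam Dt H.β ι d₁ hy₁ q hqN hq2 hq3 s' hsq n d hn hℓ

/-! ## §3 The 2-SPLIT reading is a theorem modulo three named print facts (cell `bsd-potss`, k9-c4 g11) -/

/-- **S2|₂ ⟸ {Gross 1991 Prop. 3.7 (2), Poitou–Tate duality for Selmer structures, [GZ86 III (3.1)] image-free}.**
In a Heegner field in which `2` splits, `2` is not a Kolyvagin prime (`not_isKolyvaginPrime_two_of_heegnerHypothesis_two`),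
so the one row condition of `bsd-potss`'s swap node («`2` Zhang–Kolyvagin ⇒ `ρ̄_{E,p}` onto») is idle and the body of the
Jetchev reading follows from the three named facts (`JetchevIrreducibleSwapAtP.rowDivisibilityIrredAddv_of_namedFacts_of_heegnerHypothesis_two`,
re-packaged here in this route's binder order). CONDITIONAL on the three facts; nothing asserted.
[cite: GrossLMS1991, Prop. 3.7 (2) (p. 240), §6 p. 245] [cite: MilneADT2006, Ch. I, Thm. 4.10(b)]
[cite: GrossZagier1986, III (3.1)] [cite: Jetchev2008, Thm. 1.4 (ii), Prop. 5.3, Thm. 5.2, Rem. 6.2]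
[cite: McCallumLMS1991, §5 Prop. 5.2 and proof (pp. 304–306)] -/
theorem twoSplitReading_of_namedFacts
    (h37 : GrossLMS1991.prop37_2_frobeniusCongruence)
    (hPT : ∀ (K : Type) [Field K] [NumberField K],
      Literature.NumberTheory.GaloisCohomology.poitouTate_selmerStructure_duality_conj K)
    (hF1 : Gross1991_heegnerPoint_sub_ratTorsion_mem_E0_imageFree) :
    ∀ (W : WeierstrassCurve ℚ) [W.IsElliptic] [W.IsGloballyMinimal] [NeZero (W.conductorNorm ℤ)],
      ¬ W.HasCM →
      ∀ (K : Type) [Field K] [NumberField K], IsImaginaryQuadratic K →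
      NumberField.discr K ≠ -3 → NumberField.discr K ≠ -4 →
      SatisfiesHeegnerHypothesis (W.conductorNorm ℤ) K → SatisfiesHeegnerHypothesis 2 K →
      ∀ (p : ℕ) [Fact p.Prime], p ≠ 2 → Addv W p → 0 ≤ padicValRat p W.j →
      W.HasIrreducibleModPGaloisRep p →
      ¬ p ∣ (W.baseChange ℚ_[p]).localTamagawaNumber ℤ_[p] →
      (∀ (q' : ℕ) [Fact q'.Prime], q' ∣ W.conductorNorm ℤ →
        p ∣ (W.baseChange ℚ_[q']).localTamagawaNumber ℤ_[q'] → ¬ q' ^ 2 ∣ W.conductorNorm ℤ) →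
      ∀ (Dt : ModularParametrizationData W (W.conductorNorm ℤ)) (β : ℤ) (ι : K →+* ℂ)
        (d₁ : KolyvaginHeegnerData Dt β ι 1), ¬ IsOfFinAddOrder d₁.derivedPoint →
      ∀ (q : ℕ) [Fact q.Prime], q ∣ W.conductorNorm ℤ → ¬ q ^ 2 ∣ W.conductorNorm ℤ → q ≠ p →
      ∀ (s : ℕ), s ≤ padicValNat p ((W.baseChange ℚ_[q]).localTamagawaNumber ℤ_[q]) →
      ∀ (n : ℕ) (d : KolyvaginHeegnerData Dt β ι n), Squarefree n →
        (∀ ℓ ∈ n.primeFactors, Zhang2014.IsKolyvaginPrime (W.conductorNorm ℤ) W K p ℓ ∧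
          s ≤ Zhang2014.kolyvaginIndex W p ℓ) →
        ∃ Q : (W.baseChange (ringClassField K ι n)).toAffine.Point,
          ((p ^ s : ℕ) : ℤ) • Q = d.derivedPoint :=
  fun W _ _ _ hcm K _ _ hK hD3 hD4 hH h2K p _ hp2 hadd hj hirr hcp htam Dt β ι d₁ hy q _ hqN hq2 hqp ↦
    JetchevIrreducibleSwapAtP.rowDivisibilityIrredAddv_of_namedFacts_of_heegnerHypothesis_two h37 hPT hF1 W hcm K hK
      hD3 hD4 hH h2K p hp2 hadd hj hirr hcp htam Dt β ι d₁ hy q hqN hq2 hqp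

/-- **U₁ ON ONE MONO-MULTIPLICATIVE-CARRIER ROW from PRINT + THREE NAMED FACTS + L₀ — NO S2.** §2 with the 2-split
reading discharged by §3: for `W/ℚ` globally minimal, non-CM, leaf Gss2 at `3`, `r_an(W) = 1`, a mono-multiplicative
`3`-carrier `q ∥ N_E`, the global Tamagawa binder and a datum with `3 ∤ c`: `Typed.MissingUpperBoundAt W 3` ⟸ the printed
named facts ∧ {Gross 3.7 (2), Poitou–Tate, GZ86 III (3.1)} ∧ L₀ (item 26023). On the 99 mono-carrier rank-one Gss2 classes
of the census the Jetchev reading is therefore no longer an input of U₁. CONDITIONAL on the named facts and L₀; nothing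
asserted about any curve; BSD is not proved. [cite: Jetchev2008, Thm. 1.4 and Cor. 1.5 (p. 812)]
[cite: GrossLMS1991, Prop. 3.7 (2)] [cite: MilneADT2006, Ch. I, Thm. 4.10(b)] [cite: GrossZagier1986, III (3.1)]
[cite: MatarNekovar2019, Thm. 0.7 (p. 456)] [cite: FriedbergHoffstein1995, Thm. B] [cite: Miller2011LMS, Def. 1.1] -/
theorem leafRankOneUpper_three_monoCarrier_of_namedFacts_of_lowerRankZero
    (hGZ : ∀ (N : ℕ) [NeZero N] (W : WeierstrassCurve ℚ) (K : Type) [Field K] [NumberField K],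
      gross_zagier N W K)
    (hKo : ∀ (N : ℕ) [NeZero N] (W : WeierstrassCurve ℚ) (K : Type) [Field K] [NumberField K],
      kolyvagin N W K)
    (hGZK : rank_eq_analyticRank_of_analyticRank_le_one) (hmod : hasEntireLFunction_rat)
    (hGZ73 : GrossZagier1986_thm_I_7_3)
    (hMN : MatarNekovar2019.thm07_padicValNat_card_sha_primary_add_le_of_globalDivisibility_of_irreducible)
    (hnf : exists_isNewformOf) (hFH : friedbergHoffstein_exists_heegnerField_splitDivisors_twist_ne_zero)
    (h37 : GrossLMS1991.prop37_2_frobeniusCongruence)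
    (hPT : ∀ (K : Type) [Field K] [NumberField K],
      Literature.NumberTheory.GaloisCohomology.poitouTate_selmerStructure_duality_conj K)
    (hF1 : Gross1991_heegnerPoint_sub_ratTorsion_mem_E0_imageFree)
    (hL0 : Gss2LowerAtThreeRankZero)
    (W : WeierstrassCurve ℚ) [W.IsElliptic] [W.IsGloballyMinimal] [NeZero (W.conductorNorm ℤ)]
    (hCM : ¬ W.HasCM) (hadd : Addv W 3) (hsub : SubGss W 3) (hr : W.analyticRank = 1)
    (q : ℕ) [Fact q.Prime] (hqN : q ∣ W.conductorNorm ℤ) (hq2 : ¬ q ^ 2 ∣ W.conductorNorm ℤ)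
    (hmono : padicValNat 3 W.tamagawaProduct ≤ padicValNat 3 ((W.baseChange ℚ_[q]).localTamagawaNumber ℤ_[q]))
    (htam : ∀ (q' : ℕ) [Fact q'.Prime], q' ∣ W.conductorNorm ℤ →
      3 ∣ (W.baseChange ℚ_[q']).localTamagawaNumber ℤ_[q'] → ¬ q' ^ 2 ∣ W.conductorNorm ℤ)
    (Dt : ModularParametrizationData W (W.conductorNorm ℤ)) (hc : ¬ (3 : ℤ) ∣ Dt.c) :
    MissingUpperBoundAt W 3 :=
  leafRankOneUpper_three_monoCarrier_of_twoSplitReading_of_lowerRankZero hGZ hKo hGZK hmod hGZ73 hMN hnf hFH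
    (twoSplitReading_of_namedFacts h37 hPT hF1) hL0 W hCM hadd hsub hr q hqN hq2 hmono htam Dt hc

end Summit.BirchSwinnertonDyer.BirchSwinnertonDyer.Theorems.RamifiedPairUpperBound

end
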